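import Mathlib
import Summits.SmoothPoincare4.SmoothPoincare4.Theorems.SoloBlindGenericState
import Summits.SmoothPoincare4.SmoothPoincare4.Theorems.SoloBlindCofactor
import Summits.SmoothPoincare4.SmoothPoincare4.Theorems.SoloBlindNormGap

/-!
# Ghosts of the parent: exact norms of the unit-deformations (solo-blind s8)

Exact identities behind `paper/cs-gompf-classes.md` §4e (solo seat `solo-SmoothPoincare4-blind`).
Setting (`SoloBlindGenericState`, `SoloBlindCofactor`): `f_t(x) = x³ - t x² + (t-1) x - 1`, a direction
`G = A x² + B x + C` with norm `N_t(G) = normForm A B C t`, its COFACTOR `K = cofK A B C t` (`K(θ) G(θ) = N_t(G)`)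
and the first unit multiple `M₁ ≡ x(x-1) K (mod f_t)` (`cofM₁_eq`).

For a state `J` of norm `d` at the fibre `t` and its child `J' = J_G` of norm `d' = |N_t(G)|/d²`, the polynomials
`K/d`, `M₁/d`, … lie in the colon lattice of `J'`; at the fibre `t` they reproduce `J` itself, and at a W-POSITION
`t' = t + j d'` of `J'` they give the "ghosts of the parent" `Q_ε ⊆ O_{t'}`, ideals in the class of `J'_{t'}` of norm
`|N_{t'}(M_i/d)| / d'²`.  The DEFORMATION PRINCIPLE of §4e (conjecture, certified in 40+ positions by complete
enumeration) says these ghosts are the ONLY small ideals in that class.  Their norms are given EXACTLY by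

* `norm_cofK`     : `N_t(K)  = N_t(G)²`  (norm multiplicativity, as a polynomial identity),
* `norm_cofM₁`    : `N_t(M₁) = N_t(G)²`  (`x(x-1)` is a unit of norm `1`),
* `ghost_norm_M₁` : `N_{t'}(M₁) = N_t(G)² + (t' - t) · (cusp(M₁) · (t + t') + E₁(M₁))`, where the cusp product
  `cusp(M₁) = lead · M₁(0) · M₁(1)` is `-E · p · q` with `E = AQ - AP - PQ`, `p = -(tAQ) + …`, `q = -(tAP) + …`
  (`cofM₁_cusp`), so that `N(Q_{M₁}) = |N_{t'}(M₁/d)|/d'² = j²·|e|·|A|·d'·(1 + O(t/d'))` with `e = E/d` —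
  the "margin-transfer law" of R22/R26 is the norm of a ghost.
Pure algebra (`ring`); the lattice statements are in the paper.
-/

namespace Summit.SmoothPoincare4.SmoothPoincare4.Theorems

section Ghost
variable {R : Type*} [CommRing R]

/-- Coefficients of `M₁ ≡ x(x-1)·K (mod f_t)` (read off `cofM₁_eq`). -/
def ghM₂ (A B C : R) : R := -(A ^ 2) - A * B + A * C + B * C + C ^ 2
/-- Linear coefficient of `M₁`. -/
def ghM₁ (A B C t : R) : R := t * A ^ 2 + t * A * B + A * B - 2 * A * C + B ^ 2 - B * C - C ^ 2
/-- Constant coefficient of `M₁`. -/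
def ghM₀ (A B C t : R) : R := -(t * A ^ 2) - t * A * B - t * A * C + 2 * A ^ 2 + A * C - B ^ 2 - B * C

/-- `M₁` is `x(x-1)·K` modulo `f_t` (restates `cofM₁_eq` with the named coefficients). -/
theorem ghM_eq (A B C t x : R) :
    x * (x - 1) * cofK A B C t x =
      (ghM₂ A B C * x ^ 2 + ghM₁ A B C t * x + ghM₀ A B C t)
        + fPoly t x * (cofK₂ A B C t * x + ghM₀ A B C t) := by
  unfold ghM₂ ghM₁ ghM₀ cofK cofK₂ cofK₁ cofK₀ fPoly; ring

/-- NORM OF THE COFACTOR: `N_t(K) = N_t(G)²` as a polynomial identity. -/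
theorem norm_cofK (A B C t : R) :
    normForm (cofK₂ A B C t) (cofK₁ A B C t) (cofK₀ A B C t) t = normForm A B C t ^ 2 := by
  unfold cofK₂ cofK₁ cofK₀ normForm normE₁ normE₀; ring

/-- NORM OF THE FIRST GHOST GENERATOR at the parent fibre: `N_t(M₁) = N_t(G)²`. -/
theorem norm_cofM₁ (A B C t : R) :
    normForm (ghM₂ A B C) (ghM₁ A B C t) (ghM₀ A B C t) t = normForm A B C t ^ 2 := by
  unfold ghM₂ ghM₁ ghM₀ normForm normE₁ normE₀; ring

/-- GHOST NORM at a shifted fibre `t'`: `N_{t'}(M₁) = N_t(G)² + (t' - t)(cusp(M₁)(t + t') + E₁(M₁))`. -/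
theorem ghost_norm_M₁ (A B C t t' : R) :
    normForm (ghM₂ A B C) (ghM₁ A B C t) (ghM₀ A B C t) t' =
      normForm A B C t ^ 2
        + (t' - t) * (ghM₂ A B C * ghM₀ A B C t * (ghM₂ A B C + ghM₁ A B C t + ghM₀ A B C t) * (t + t')
            + normE₁ (ghM₂ A B C) (ghM₁ A B C t) (ghM₀ A B C t)) := by
  have h := normForm_fibre_shift (ghM₂ A B C) (ghM₁ A B C t) (ghM₀ A B C t) t t'
  rw [norm_cofM₁] at h
  linear_combination h

/-- The cusp product of `M₁` is `-E · p₁ · q₁` with `P = C`, `Q = A + B + C`, `E = AQ - AP - PQ`,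
`p₁ = M₁(0) = -(tAQ) + A² + 2AQ + PQ - Q²`, `q₁ = M₁(1) = -(tAP) + A² + AP + P² - PQ`. -/
theorem ghost_cusp_M₁ (A B C t : R) :
    ghM₂ A B C * ghM₀ A B C t * (ghM₂ A B C + ghM₁ A B C t + ghM₀ A B C t) =
      -(A * (A + B + C) - A * C - C * (A + B + C))
        * (-(t * A * (A + B + C)) + A ^ 2 + 2 * A * (A + B + C) + C * (A + B + C) - (A + B + C) ^ 2)
        * (-(t * A * C) + A ^ 2 + A * C + C ^ 2 - C * (A + B + C)) := by
  unfold ghM₂ ghM₁ ghM₀; ring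

/-- At a W-position `t' = t + j·d'` with `N_t(G) = s·d²·d'` (`s = ±1`, so `s² = 1`): the ghost generator `M₁/d`
has `N_{t'}(M₁) = d'²·(d⁴ + j·(cusp(M₁)·(2t + j d') + E₁(M₁))·… )`; precisely
`N_{t'}(M₁) = d⁴ d'² + j d' (cusp(M₁) (2 t + j d') + E₁(M₁))`. -/
theorem ghost_norm_position (A B C t d d' j s : R) (hs : s ^ 2 = 1)
    (hN : normForm A B C t = s * d ^ 2 * d') :
    normForm (ghM₂ A B C) (ghM₁ A B C t) (ghM₀ A B C t) (t + j * d') =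
      d ^ 4 * d' ^ 2
        + j * d' * (ghM₂ A B C * ghM₀ A B C t * (ghM₂ A B C + ghM₁ A B C t + ghM₀ A B C t) * (2 * t + j * d')
            + normE₁ (ghM₂ A B C) (ghM₁ A B C t) (ghM₀ A B C t)) := by
  rw [ghost_norm_M₁, hN]
  linear_combination (d ^ 4 * d' ^ 2) * hs

end Ghost

end Summit.SmoothPoincare4.SmoothPoincare4.Theorems
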